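import Summits.QuantumFields.YangMills.Theorems.BalabanUVNodesN15TwoSpacingGluingCommutator
import Summits.QuantumFields.YangMills.Theorems.BalabanUVNodesN15CovariantLaplacianSpecies
import HarnessLib

/-!
# THE GLUING STEP AT TWO LATTICE SPACINGS, X: the COVARIANT edition of FILE 46 — for Bałaban's covariant Laplacian (3.50) `Δ_R = −η⁻¹Σ_μ(D⁺_μ + D⁻_μ)` (g10 FILE 28 `covLapM`, n15-b `covD`)
# and a SCALAR partition function `h`: `[Δ_R, M_h] = Σ_μ [M_{∇*_μ∇_μh} − M_{∇_μh}∘D⁺_μ − M_{∇*_μh}∘D⁻_μ]` EXACTLY (arbitrary transports `R`, every `η`), the (2.134) letter of `[Δ_R + W, M_h]∘G`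
# from the cube's COVARIANT entries 0∕1, its η-defect, and the glued two-grid defect from covariant cube entries (dag-n15-c g11, FILE 52; N15 = NE2, s1 «background-layer OPERATOR
# ingredient»; answers ref-F READ-450 NIT-2)

Cell `pub-ymgap`, seat `pub-ymgap-dag-n15-c` (R134 (a); HUMAN RULING D-0062), generation 11.  `bears_on: R4∕N15 · K3⁷ SpineGivenEndpointR13SepCoPH (stmt-QuantumFields-20544)`.
Filed `--supports stmt-QuantumFields-20544 --as helper` — COUNT-NEUTRAL.  Theorems only (0 `def`, 0 `sorry`).  Imports BY NAME FILE 46 `…N15TwoSpacingGluingCommutator` (`commOp`,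
`commOp_add_left`, `commOp_fsum_left`, `hasMaj_mulOp_comp_loc`, `hasMaj_idef_mulOp_comp_loc`, FILE 45's `hasMaj_idef_glued_of_cubes`, g8 `fgrad`∕`fgradAdj`) and g10 FILE 28
`…N15CovariantLaplacianSpecies` (`covLapM`; through it n15-b part 18 `covD`, `covD_apply`); nothing in the tree is modified.

WHY.  FILE 46 typed the lattice Leibniz identity for the FLAT `∇*∇` (`lapDir`); referee ref-F (READ-450 NIT-2): *«`lapDir` is the FLAT scalar `∇*∇` … [B9] (3.26)'s covariant `Δ(U)` has
the same three-term commutator with a scalar `M_h`, but a `U`-covariant consumer must re-derive §1 on a `U`-twisted `fgrad`.»*  THIS FILE re-derives it on n15-b's covariant derivative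
`(D f)(x, i) = η⁻¹(Σ_j R(x)_{ij} f(sx, j) − f(x, i))` (`covD η R s`; transports `R(x)` = the parallel transporters of the background `U` along the bond): a scalar `h` (acting as
`(M_h f)(x, i) = h(x)f(x, i)`) commutes with `R(x)`, so ★ `commOp_covD_scalar`: `[D, M_h] = M_{h∘s − h}∘D + M_{η⁻¹(h∘s − h)}`; summing over bonds and orientations (the backward `D⁻_μ = covD η
R⁻_μ τ_μ⁻¹` is `∇*_μ = −∇⁻_μ` at `R ≡ 1`), ★★ `commOp_covLapM_scalar`: `[Δ_R, M_h] = Σ_μ [M_{∇*_μ∇_μh} − M_{∇_μh}∘D⁺_μ − M_{∇*_μh}∘D⁻_μ]` with `∇_μ = fgrad η⁻¹ τ_μ`, `∇*_μ = fgradAdj η⁻¹ τ_μ`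
— EXACT for ARBITRARY transports (any background, any `η`, also `η = 0` under Lean's `0⁻¹ = 0`); at `R ≡ 1` it is FILE 46's `commOp_lapDir` summed; ★ `covD_comp_mulOp_scalar` ∕
`mulOp_scalar_comp_covD` — the LEFT ∕ RIGHT two-term Leibniz forms `D∘M_h = M_{h∘s}∘D + M_{η⁻¹(h∘s−h)}`, `M_h∘D_e = D_e∘M_{h∘e⁻¹} + M_{∇*_e h}` = FILE 48's `hleib` rows for the dressed
parametrices `D∘G₀`, `G₀∘E` with covariant `D`, `E`.  Then, verbatim in FILE 46's bookkeeping: ★ `commOp_covLapM_comp` (`[Δ_R + W, M_h]∘G` = cube entries 0∕1 + the `W`-part), ★★ `hasMaj_commOp_covLapM_comp` (the (2.134) letter `≤ 1_S1_S(|J|(c₂β + 2c₁β₁) + θ_W)e^{−δd}`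
from the COVARIANT cube entries `D^±_μ∘G ≤ 1_S1_Sβ₁e^{−δd}`), ★★ `hasMaj_idef_commOp_covLapM_comp` (its η-defect along any restriction map `ϖ : X′ × ι → X × ι` of the product
carriers), ★★★ `hasMaj_idef_glued_of_covEntries` (FILE 45's glued two-grid defect with every letter = covariant cube entries + partition smoothness + the `W`-part, smallness
`N_ov·θ₀·c_r < 1` with `θ₀ = |J|(c₂β + 2c₁β₁) + θ_W` LIVE).

HONEST FRAMING ∕ LIMITS.  Lattice algebra + diagonal block-majorant bookkeeping ([B9] (3.50)–(3.52) p.400, (3.26) p.395, p.399 (architecture); [B5] (1.2)–(1.3) p.18; [B6] (2.91)–(2.92)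
p.239, (2.133)–(2.136) p.247 = SHAPES ∕ MECHANISM; nothing asserted).  The covariant cube entries, their two-grid defects and the `W`-part (`Q*(U)aQ(U)`: FILE 51; `D_UR(U)D_U*`) stay
displayed.  NE2⁺ NOT PRINTED, NOT proved; N15 NOT discharged; counts of record UNMOVED (typed 28∕28 · discharged 5∕27); one finite 𝕋⁴ at fixed ε — NOT infinite volume, NOT OS on ℝ⁴,
NOT a mass gap, NOT Clay; R4 closes the conditional finite-𝕋⁴ rung `BalabanLadder.UV` only.  Restate-immune (no Theses import).
-/

noncomputable section

namespace Summit.QuantumFields.YangMills.BalabanUVNodes.N15.Gluing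

open Literature.MathematicalPhysics.QuantumFieldTheory.Balaban1983to89
open Literature.MathematicalPhysics.QuantumFieldTheory.Balaban1983to89.B11SectG (BlockNorm HasMaj RowSum)
open Literature.MathematicalPhysics.QuantumFieldTheory.Balaban1983to89.T4EtaRateDefect (idef idef_sub idef_add)
open Literature.MathematicalPhysics.QuantumFieldTheory.Balaban1983to89.T4EtaRateCoeffDefect (pull)
open Literature.MathematicalPhysics.QuantumFieldTheory.Balaban1983to89.B6RandomWalk (Triangle254)
open Literature.MathematicalPhysics.QuantumFieldTheory.Balaban1983to89.B6Prop26Gluing (mulOp mulOp_apply ind)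
open Summit.QuantumFields.YangMills.BalabanUVNodes.N15.BackgroundLayer (fgrad fgradAdj fgrad_apply fgradAdj_apply covLapM)
open Summit.QuantumFields.YangMills.BalabanUVNodes.N15.MatrixSpecies (covD covD_apply)

/-! ## §1 The covariant lattice Leibniz identity -/

section Linear

variable {Y : Type}

/-- `[−Δ, M_a] = −[Δ, M_a]`. [folklore] -/
theorem commOp_neg_left (Δ : (Y → ℝ) →ₗ[ℝ] (Y → ℝ)) (a : Y → ℝ) : commOp (-Δ) a = -commOp Δ a := by
  rw [commOp, commOp, LinearMap.neg_comp, LinearMap.comp_neg]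
  abel

/-- `[c•Δ, M_a] = c•[Δ, M_a]`. [folklore] -/
theorem commOp_smul_left (c : ℝ) (Δ : (Y → ℝ) →ₗ[ℝ] (Y → ℝ)) (a : Y → ℝ) : commOp (c • Δ) a = c • commOp Δ a := by
  rw [commOp, commOp, LinearMap.smul_comp, LinearMap.comp_smul, smul_sub]

end Linear

section Leibniz

variable {X J ι : Type} [Fintype J] [Fintype ι] [DecidableEq ι]

omit [Fintype J] in
/-- ★ **THE COVARIANT LEIBNIZ IDENTITY, one bond**: for `D = covD η R s` and a SCALAR `h`, `[D, M_h] = M_{h∘s − h}∘D + M_{η⁻¹(h∘s − h)}` — the transport `R(x)` commutes with `h(x)`.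
[cite: Balaban1985BackgroundPropagators, (3.50)–(3.52) p.400 (covariant derivative: shape); Balaban1984PropagatorsI, (1.2)–(1.3) p.18 (lattice derivatives)] -/
theorem commOp_covD_scalar (η : ℝ) (R : X → Matrix ι ι ℝ) (s : X → X) (h : X → ℝ) :
    commOp (covD η R s) (fun p : X × ι => h p.1) =
      mulOp (fun p : X × ι => h (s p.1) - h p.1) ∘ₗ covD η R s + mulOp (fun p : X × ι => η⁻¹ * (h (s p.1) - h p.1)) := by
  refine LinearMap.ext fun f => funext fun p => ?_
  simp only [commOp, LinearMap.sub_apply, LinearMap.add_apply, LinearMap.comp_apply, Pi.sub_apply, Pi.add_apply, mulOp_apply, covD_apply]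
  have hsum : ∑ j, R p.1 p.2 j * (h (s p.1, j).1 * f (s p.1, j)) = h (s p.1) * ∑ j, R p.1 p.2 j * f (s p.1, j) := by
    rw [Finset.mul_sum]; exact Finset.sum_congr rfl fun j _ => by ring
  rw [hsum]
  ring

omit [Fintype J] in
/-- ★ **LEFT LEIBNIZ FORM** — FILE 48's `hleib` for the covariant entry 1 (`comp_parametrix_of_leibniz`, `hasMaj_comp_parametrix`, `hasMaj_idef_comp_parametrix` at `hs := h∘s`,
`dh := η⁻¹(h∘s − h)`): `D∘M_h = M_{h∘s}∘D + M_{η⁻¹(h∘s − h)}`. [cite: Balaban1984PropagatorsII, (2.136) p.247 (entries: mechanism); Balaban1985BackgroundPropagators, (3.52) p.400] -/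
theorem covD_comp_mulOp_scalar (η : ℝ) (R : X → Matrix ι ι ℝ) (s : X → X) (h : X → ℝ) :
    covD η R s ∘ₗ mulOp (fun p : X × ι => h p.1) = mulOp (fun p : X × ι => h (s p.1)) ∘ₗ covD η R s + mulOp (fun p : X × ι => η⁻¹ * (h (s p.1) - h p.1)) := by
  refine LinearMap.ext fun f => funext fun p => ?_
  simp only [LinearMap.add_apply, LinearMap.comp_apply, Pi.add_apply, mulOp_apply, covD_apply]
  have hsum : ∑ j, R p.1 p.2 j * (h (s p.1, j).1 * f (s p.1, j)) = h (s p.1) * ∑ j, R p.1 p.2 j * f (s p.1, j) := by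
    rw [Finset.mul_sum]; exact Finset.sum_congr rfl fun j _ => by ring
  rw [hsum]
  ring

omit [Fintype J] in
/-- ★ **RIGHT LEIBNIZ FORM** — FILE 48's `hleib` for the adjoint arrangement (`parametrix_comp_of_leibniz`, `hasMaj_parametrix_comp`, `hasMaj_idef_parametrix_comp` at `hs := h∘e⁻¹`,
`dh := ∇*_e h = η⁻¹(h∘e⁻¹ − h)`), invertible shift `e`: `M_h∘D = D∘M_{h∘e⁻¹} + M_{∇*_e h}` (`∇*_e = fgradAdj η⁻¹ e`). [cite: Balaban1984PropagatorsII, (2.136) p.247 (entries: mechanism, transposed)] -/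
theorem mulOp_scalar_comp_covD (η : ℝ) (R : X → Matrix ι ι ℝ) (e : X ≃ X) (h : X → ℝ) :
    mulOp (fun p : X × ι => h p.1) ∘ₗ covD η R e = covD η R e ∘ₗ mulOp (fun p : X × ι => h (e.symm p.1)) + mulOp (fun p : X × ι => fgradAdj η⁻¹ e h p.1) := by
  refine LinearMap.ext fun f => funext fun p => ?_
  simp only [LinearMap.add_apply, LinearMap.comp_apply, Pi.add_apply, mulOp_apply, covD_apply, fgradAdj_apply, Equiv.symm_apply_apply]
  have hsum : ∑ j, R p.1 p.2 j * (h p.1 * f (e p.1, j)) = h p.1 * ∑ j, R p.1 p.2 j * f (e p.1, j) := by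
    rw [Finset.mul_sum]; exact Finset.sum_congr rfl fun j _ => by ring
  rw [hsum]
  ring

/-- ★★ **THE COVARIANT EDITION OF FILE 46's `commOp_lapDir`**: for Bałaban's covariant Laplacian (3.50) `Δ_R = −η⁻¹Σ_μ(D⁺_μ + D⁻_μ)` (`covLapM τ η R`) and a scalar `h`,
`[Δ_R, M_h] = Σ_μ [M_{∇*_μ∇_μh} − M_{∇_μh}∘D⁺_μ − M_{∇*_μh}∘D⁻_μ]`, `∇_μ = fgrad η⁻¹ τ_μ`, `∇*_μ = fgradAdj η⁻¹ τ_μ` (`= −∇⁻_μ`) — EXACT for ARBITRARY transports `R` and every `η`.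
[cite: Balaban1985BackgroundPropagators, (3.50) p.400, (3.26) p.395; Balaban1984PropagatorsII, (2.92) p.239 (mechanism)] -/
theorem commOp_covLapM_scalar (τ : J → X ≃ X) (η : ℝ) (R : J ⊕ J → X → Matrix ι ι ℝ) (h : X → ℝ) :
    commOp (covLapM τ η R) (fun p : X × ι => h p.1) =
      ∑ μ, (mulOp (fun p : X × ι => fgradAdj η⁻¹ (τ μ) (fgrad η⁻¹ (τ μ) h) p.1) - mulOp (fun p : X × ι => fgrad η⁻¹ (τ μ) h p.1) ∘ₗ covD η (R (Sum.inl μ)) (τ μ) -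
        mulOp (fun p : X × ι => fgradAdj η⁻¹ (τ μ) h p.1) ∘ₗ covD η (R (Sum.inr μ)) (τ μ).symm) := by
  rw [covLapM, commOp_neg_left, commOp_smul_left, commOp_fsum_left, Finset.smul_sum, ← Finset.sum_neg_distrib]
  refine Finset.sum_congr rfl fun μ _ => ?_
  rw [commOp_add_left, commOp_covD_scalar, commOp_covD_scalar]
  refine LinearMap.ext fun f => funext fun p => ?_
  simp only [LinearMap.neg_apply, LinearMap.smul_apply, LinearMap.add_apply, LinearMap.sub_apply, LinearMap.comp_apply, Pi.neg_apply, Pi.smul_apply, Pi.add_apply, Pi.sub_apply,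
    smul_eq_mul, mulOp_apply, fgrad_apply, fgradAdj_apply, Equiv.apply_symm_apply]
  ring

/-- ★ **THE COMMUTATOR PIECE OF THE REMAINDER, covariant Laplacian-type `Δ_R + W`**: `[Δ_R + W, M_h]∘G = Σ_μ [M_{∇*_μ∇_μh}∘G − M_{∇_μh}∘(D⁺_μ∘G) − M_{∇*_μh}∘(D⁻_μ∘G)] + [W, M_h]∘G` — only
the cube's COVARIANT entries 0 and 1 (both orientations) and the `W`-part appear. [cite: Balaban1984PropagatorsII, (2.91)–(2.92) p.239 (mechanism); Balaban1985BackgroundPropagators, p.399] -/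
theorem commOp_covLapM_comp (τ : J → X ≃ X) (η : ℝ) (R : J ⊕ J → X → Matrix ι ι ℝ) (W G : (X × ι → ℝ) →ₗ[ℝ] (X × ι → ℝ)) (h : X → ℝ) :
    commOp (covLapM τ η R + W) (fun p : X × ι => h p.1) ∘ₗ G =
      (∑ μ, (mulOp (fun p : X × ι => fgradAdj η⁻¹ (τ μ) (fgrad η⁻¹ (τ μ) h) p.1) ∘ₗ G - mulOp (fun p : X × ι => fgrad η⁻¹ (τ μ) h p.1) ∘ₗ (covD η (R (Sum.inl μ)) (τ μ) ∘ₗ G) -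
        mulOp (fun p : X × ι => fgradAdj η⁻¹ (τ μ) h p.1) ∘ₗ (covD η (R (Sum.inr μ)) (τ μ).symm ∘ₗ G))) + commOp W (fun p : X × ι => h p.1) ∘ₗ G := by
  rw [commOp_add_left, LinearMap.add_comp, commOp_covLapM_scalar]
  congr 1
  refine LinearMap.ext fun f => ?_
  simp only [LinearMap.comp_apply, LinearMap.coe_sum, Finset.sum_apply, LinearMap.sub_apply]

end Leibniz

/-! ## §2 The (2.134) letter of the covariant commutator piece from the cube's covariant entries 0∕1 and the partition's smoothness -/

section Letter

variable {X J ι : Type} [Fintype X] [Fintype J] [Fintype ι] [DecidableEq ι] {g : B6.Geometry} (blk : X × ι → g.Site)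

/-- ★★ **THE COVARIANT (2.134) LETTER FROM COVARIANT CUBE ENTRIES 0∕1**: with `G ≤ 1_S1_S·βe^{−δd}`, `D⁺_μG, D⁻_μG ≤ 1_S1_S·β₁e^{−δd}` (entries 0∕1 of the covariant cube propagator,
both orientations), the partition's `|∇_μh|, |∇*_μh| ≤ c₁`, `|∇*_μ∇_μh| ≤ c₂` and the `W`-commutator letter `[W, M_h]G ≤ 1_S1_S·θ_We^{−δd}`:
`[Δ_R + W, M_h]∘G ≤ 1_S(y)1_S(y′)·(|J|·(c₂β + 2c₁β₁) + θ_W)·e^{−δd}` — the same `θ₀` as the flat case, `O(M⁻¹)` when `c₁ = O(M⁻¹)`, `c₂ = O(M⁻²)`, for ARBITRARY transports.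
[cite: Balaban1984PropagatorsII, (2.133)–(2.134) p.247 (shapes + mechanism); Balaban1985BackgroundPropagators, (3.50) p.400] -/
theorem hasMaj_commOp_covLapM_comp {τ : J → X ≃ X} {η : ℝ} {R : J ⊕ J → X → Matrix ι ι ℝ} {W G : (X × ι → ℝ) →ₗ[ℝ] (X × ι → ℝ)} {h : X → ℝ} {S : Set g.Site}
    {β β₁ c₁ c₂ θW δ : ℝ} (hc₁ : 0 ≤ c₁) (hc₂ : 0 ≤ c₂)
    (hh1 : ∀ μ x, |fgrad η⁻¹ (τ μ) h x| ≤ c₁) (hh1b : ∀ μ x, |fgradAdj η⁻¹ (τ μ) h x| ≤ c₁) (hh2 : ∀ μ x, |fgradAdj η⁻¹ (τ μ) (fgrad η⁻¹ (τ μ) h) x| ≤ c₂)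
    (hG : HasMaj (BlockNorm.ofBlocks g blk) (BlockNorm.ofBlocks g blk) G (fun y y' => ind S y * ind S y' * (β * Real.exp (-(δ * g.dist y y')))))
    (hD : ∀ μ, HasMaj (BlockNorm.ofBlocks g blk) (BlockNorm.ofBlocks g blk) (covD η (R (Sum.inl μ)) (τ μ) ∘ₗ G)
      (fun y y' => ind S y * ind S y' * (β₁ * Real.exp (-(δ * g.dist y y')))))
    (hDb : ∀ μ, HasMaj (BlockNorm.ofBlocks g blk) (BlockNorm.ofBlocks g blk) (covD η (R (Sum.inr μ)) (τ μ).symm ∘ₗ G)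
      (fun y y' => ind S y * ind S y' * (β₁ * Real.exp (-(δ * g.dist y y')))))
    (hW : HasMaj (BlockNorm.ofBlocks g blk) (BlockNorm.ofBlocks g blk) (commOp W (fun p : X × ι => h p.1) ∘ₗ G) (fun y y' => ind S y * ind S y' * (θW * Real.exp (-(δ * g.dist y y'))))) :
    HasMaj (BlockNorm.ofBlocks g blk) (BlockNorm.ofBlocks g blk) (commOp (covLapM τ η R + W) (fun p : X × ι => h p.1) ∘ₗ G)
      (fun y y' => ind S y * ind S y' * ((Fintype.card J * (c₂ * β + 2 * (c₁ * β₁)) + θW) * Real.exp (-(δ * g.dist y y')))) := by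
  have hterm : ∀ μ, HasMaj (BlockNorm.ofBlocks g blk) (BlockNorm.ofBlocks g blk)
      (mulOp (fun p : X × ι => fgradAdj η⁻¹ (τ μ) (fgrad η⁻¹ (τ μ) h) p.1) ∘ₗ G - mulOp (fun p : X × ι => fgrad η⁻¹ (τ μ) h p.1) ∘ₗ (covD η (R (Sum.inl μ)) (τ μ) ∘ₗ G) -
        mulOp (fun p : X × ι => fgradAdj η⁻¹ (τ μ) h p.1) ∘ₗ (covD η (R (Sum.inr μ)) (τ μ).symm ∘ₗ G))
      (fun y y' => ind S y * ind S y' * ((c₂ * β + 2 * (c₁ * β₁)) * Real.exp (-(δ * g.dist y y')))) := fun μ => by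
    have t0 := hasMaj_mulOp_comp_loc blk (a := fun p : X × ι => fgradAdj η⁻¹ (τ μ) (fgrad η⁻¹ (τ μ) h) p.1) hc₂ (fun p => hh2 μ p.1) hG
    have t1 := hasMaj_mulOp_comp_loc blk (a := fun p : X × ι => fgrad η⁻¹ (τ μ) h p.1) hc₁ (fun p => hh1 μ p.1) (hD μ)
    have t2 := hasMaj_mulOp_comp_loc blk (a := fun p : X × ι => fgradAdj η⁻¹ (τ μ) h p.1) hc₁ (fun p => hh1b μ p.1) (hDb μ)
    refine ((t0.sub t1).sub t2).mono fun y y' => le_of_eq ?_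
    ring
  have hsum := hasMaj_fsum (b₁ := BlockNorm.ofBlocks g blk) (b₃ := BlockNorm.ofBlocks g blk) Finset.univ _ _ fun μ _ => hterm μ
  rw [commOp_covLapM_comp]
  refine (hsum.add hW).mono fun y y' => le_of_eq ?_
  simp only [Finset.sum_const, Finset.card_univ, nsmul_eq_mul]
  ring

end Letter

/-! ## §3 The η-defect of the covariant commutator piece along a restriction map `ϖ : X′ × ι → X × ι` of the product carriers -/

section LetterDefect

variable {X X' J ι : Type} [Fintype X] [Fintype X'] [Fintype J] [Fintype ι] [DecidableEq ι] {g : B6.Geometry} (blk : X × ι → g.Site) (ϖ : X' × ι → X × ι)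

/-- ★★ **THE η-DEFECT OF THE COVARIANT (2.134) PIECE FROM COVARIANT CUBE ENTRY-0∕1 DEFECTS**: fine letters `|∇′h′|, |∇′*h′| ≤ c₁`, `|∇′*∇′h′| ≤ c₂`, fits along `ϖ` of the derivative
letters `≤ o₁`, `≤ o₂`, coarse covariant cube entries `G, D^±G ≤ 1_S1_S·(β, β₁)e^{−δd}`, their two-grid defects `𝔇(G′,G) ≤ 1_S1_S·m₀e^{−δd}`, `𝔇(D′^±G′, D^±G) ≤ 1_S1_S·m₁e^{−δd}`
(transports `R, R′` at the two spacings — arbitrary), and the `W`-part's defect letter `r_W`: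
`𝔇([Δ′_{R′} + W′, M_{h′}]G′, [Δ_R + W, M_h]G) ≤ 1_S1_S·(|J|(c₂m₀ + o₂β + 2(c₁m₁ + o₁β₁)) + r_W)·e^{−δd}`.
[cite: Balaban1984PropagatorsII, (2.133)–(2.134) p.247 (shapes); Balaban1985BackgroundPropagators, Thm 3.14 pp.426–427 (difference template)] -/
theorem hasMaj_idef_commOp_covLapM_comp {τ : J → X ≃ X} {τ' : J → X' ≃ X'} {η η' : ℝ} {R : J ⊕ J → X → Matrix ι ι ℝ} {R' : J ⊕ J → X' → Matrix ι ι ℝ}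
    {W G : (X × ι → ℝ) →ₗ[ℝ] (X × ι → ℝ)} {W' G' : (X' × ι → ℝ) →ₗ[ℝ] (X' × ι → ℝ)} {h : X → ℝ} {h' : X' → ℝ} {S : Set g.Site} {β β₁ c₁ c₂ o₁ o₂ m₀ m₁ rW δ : ℝ}
    (hc₁ : 0 ≤ c₁) (hc₂ : 0 ≤ c₂) (ho₁ : 0 ≤ o₁) (ho₂ : 0 ≤ o₂)
    (hh1 : ∀ μ x', |fgrad η'⁻¹ (τ' μ) h' x'| ≤ c₁) (hh1b : ∀ μ x', |fgradAdj η'⁻¹ (τ' μ) h' x'| ≤ c₁) (hh2 : ∀ μ x', |fgradAdj η'⁻¹ (τ' μ) (fgrad η'⁻¹ (τ' μ) h') x'| ≤ c₂)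
    (hf1 : ∀ μ p', |fgrad η'⁻¹ (τ' μ) h' p'.1 - fgrad η⁻¹ (τ μ) h (ϖ p').1| ≤ o₁) (hf1b : ∀ μ p', |fgradAdj η'⁻¹ (τ' μ) h' p'.1 - fgradAdj η⁻¹ (τ μ) h (ϖ p').1| ≤ o₁)
    (hf2 : ∀ μ p', |fgradAdj η'⁻¹ (τ' μ) (fgrad η'⁻¹ (τ' μ) h') p'.1 - fgradAdj η⁻¹ (τ μ) (fgrad η⁻¹ (τ μ) h) (ϖ p').1| ≤ o₂)
    (hG : HasMaj (BlockNorm.ofBlocks g blk) (BlockNorm.ofBlocks g blk) G (fun y y' => ind S y * ind S y' * (β * Real.exp (-(δ * g.dist y y')))))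
    (hD : ∀ μ, HasMaj (BlockNorm.ofBlocks g blk) (BlockNorm.ofBlocks g blk) (covD η (R (Sum.inl μ)) (τ μ) ∘ₗ G) (fun y y' => ind S y * ind S y' * (β₁ * Real.exp (-(δ * g.dist y y')))))
    (hDb : ∀ μ, HasMaj (BlockNorm.ofBlocks g blk) (BlockNorm.ofBlocks g blk) (covD η (R (Sum.inr μ)) (τ μ).symm ∘ₗ G)
      (fun y y' => ind S y * ind S y' * (β₁ * Real.exp (-(δ * g.dist y y')))))
    (hDG : HasMaj (BlockNorm.ofBlocks g blk) (BlockNorm.ofBlocks g (blk ∘ ϖ)) (idef (pull ϖ) (pull ϖ) G' G) (fun y y' => ind S y * ind S y' * (m₀ * Real.exp (-(δ * g.dist y y')))))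
    (hDD : ∀ μ, HasMaj (BlockNorm.ofBlocks g blk) (BlockNorm.ofBlocks g (blk ∘ ϖ)) (idef (pull ϖ) (pull ϖ) (covD η' (R' (Sum.inl μ)) (τ' μ) ∘ₗ G') (covD η (R (Sum.inl μ)) (τ μ) ∘ₗ G))
      (fun y y' => ind S y * ind S y' * (m₁ * Real.exp (-(δ * g.dist y y')))))
    (hDDb : ∀ μ, HasMaj (BlockNorm.ofBlocks g blk) (BlockNorm.ofBlocks g (blk ∘ ϖ))
      (idef (pull ϖ) (pull ϖ) (covD η' (R' (Sum.inr μ)) (τ' μ).symm ∘ₗ G') (covD η (R (Sum.inr μ)) (τ μ).symm ∘ₗ G))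
      (fun y y' => ind S y * ind S y' * (m₁ * Real.exp (-(δ * g.dist y y')))))
    (hDW : HasMaj (BlockNorm.ofBlocks g blk) (BlockNorm.ofBlocks g (blk ∘ ϖ))
      (idef (pull ϖ) (pull ϖ) (commOp W' (fun p' : X' × ι => h' p'.1) ∘ₗ G') (commOp W (fun p : X × ι => h p.1) ∘ₗ G))
      (fun y y' => ind S y * ind S y' * (rW * Real.exp (-(δ * g.dist y y'))))) :
    HasMaj (BlockNorm.ofBlocks g blk) (BlockNorm.ofBlocks g (blk ∘ ϖ))
      (idef (pull ϖ) (pull ϖ) (commOp (covLapM τ' η' R' + W') (fun p' : X' × ι => h' p'.1) ∘ₗ G') (commOp (covLapM τ η R + W) (fun p : X × ι => h p.1) ∘ₗ G))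
      (fun y y' => ind S y * ind S y' * ((Fintype.card J * (c₂ * m₀ + o₂ * β + 2 * (c₁ * m₁ + o₁ * β₁)) + rW) * Real.exp (-(δ * g.dist y y')))) := by
  have hterm : ∀ μ, HasMaj (BlockNorm.ofBlocks g blk) (BlockNorm.ofBlocks g (blk ∘ ϖ))
      (idef (pull ϖ) (pull ϖ)
        (mulOp (fun p' : X' × ι => fgradAdj η'⁻¹ (τ' μ) (fgrad η'⁻¹ (τ' μ) h') p'.1) ∘ₗ G' -
            mulOp (fun p' : X' × ι => fgrad η'⁻¹ (τ' μ) h' p'.1) ∘ₗ (covD η' (R' (Sum.inl μ)) (τ' μ) ∘ₗ G') -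
          mulOp (fun p' : X' × ι => fgradAdj η'⁻¹ (τ' μ) h' p'.1) ∘ₗ (covD η' (R' (Sum.inr μ)) (τ' μ).symm ∘ₗ G'))
        (mulOp (fun p : X × ι => fgradAdj η⁻¹ (τ μ) (fgrad η⁻¹ (τ μ) h) p.1) ∘ₗ G - mulOp (fun p : X × ι => fgrad η⁻¹ (τ μ) h p.1) ∘ₗ (covD η (R (Sum.inl μ)) (τ μ) ∘ₗ G) -
          mulOp (fun p : X × ι => fgradAdj η⁻¹ (τ μ) h p.1) ∘ₗ (covD η (R (Sum.inr μ)) (τ μ).symm ∘ₗ G)))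
      (fun y y' => ind S y * ind S y' * ((c₂ * m₀ + o₂ * β + 2 * (c₁ * m₁ + o₁ * β₁)) * Real.exp (-(δ * g.dist y y')))) := fun μ => by
    have t0 := hasMaj_idef_mulOp_comp_loc blk ϖ (a := fun p : X × ι => fgradAdj η⁻¹ (τ μ) (fgrad η⁻¹ (τ μ) h) p.1)
      (a' := fun p' : X' × ι => fgradAdj η'⁻¹ (τ' μ) (fgrad η'⁻¹ (τ' μ) h') p'.1) hc₂ ho₂ (fun p' => hh2 μ p'.1) (hf2 μ) hG hDG
    have t1 := hasMaj_idef_mulOp_comp_loc blk ϖ (a := fun p : X × ι => fgrad η⁻¹ (τ μ) h p.1) (a' := fun p' : X' × ι => fgrad η'⁻¹ (τ' μ) h' p'.1) hc₁ ho₁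
      (fun p' => hh1 μ p'.1) (hf1 μ) (hD μ) (hDD μ)
    have t2 := hasMaj_idef_mulOp_comp_loc blk ϖ (a := fun p : X × ι => fgradAdj η⁻¹ (τ μ) h p.1) (a' := fun p' : X' × ι => fgradAdj η'⁻¹ (τ' μ) h' p'.1) hc₁ ho₁
      (fun p' => hh1b μ p'.1) (hf1b μ) (hDb μ) (hDDb μ)
    rw [idef_sub, idef_sub]
    refine ((t0.sub t1).sub t2).mono fun y y' => le_of_eq ?_
    ring
  have hsum := hasMaj_fsum (b₁ := BlockNorm.ofBlocks g blk) (b₃ := BlockNorm.ofBlocks g (blk ∘ ϖ)) Finset.univ _ _ fun μ _ => hterm μ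
  rw [commOp_covLapM_comp, commOp_covLapM_comp, idef_add, idef_fsum]
  refine (hsum.add hDW).mono fun y y' => le_of_eq ?_
  simp only [Finset.sum_const, Finset.card_univ, nsmul_eq_mul]
  ring

end LetterDefect

/-! ## §4 The glued global propagator of a covariant `Δ_R + W`: every letter = covariant cube entries 0∕1 + partition smoothness + the `W`-part -/

section Glued

variable {X X' J ι K : Type} [Fintype X] [Fintype X'] [DecidableEq X] [DecidableEq X'] [Fintype J] [Fintype ι] [DecidableEq ι] [Fintype K] {g : B6.Geometry}
  (blk : X × ι → g.Site) (ϖ : X' × ι → X × ι) (S : K → Set g.Site) {σ cr : ℝ}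

/-- ★★★ **THE η-DEFECT OF THE GLUED GLOBAL PROPAGATOR OF A COVARIANT `Δ_R + W` FROM COVARIANT CUBE ENTRIES.**  Data at two spacings `η, η′`: translations `τ, τ′`, transports `R, R′` (arbitrary),
local parts `W, W′`, cube propagators `G_□, G_□′` on the product carriers with covariant entries 0∕1 (both orientations) localized to reaches `S_□` of overlap `≤ N_ov` (`β, β₁`) and their
two-grid defects along `ϖ` (`m₀, m₁`), a scalar quadratic partition `h, h′` (`|h| ≤ 1`, fits `o`, derivative letters `c₁, c₂`, derivative fits `o₁, o₂`), the `W`-commutator letters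
(`θ_W`, `r_W`).  With `θ₀ := |J|(c₂β + 2c₁β₁) + θ_W` and the ONE smallness `N_ov·θ₀·c_r < 1`: `𝔇(G′, G) ≤ C·e^{−(δ−2σ)d}` for the glued inverses of FILE 45 — `C` = FILE 45's constant at
`r := |J|(c₂m₀ + o₂β + 2(c₁m₁ + o₁β₁)) + r_W`; the background enters ONLY through the displayed covariant cube letters.
[cite: Balaban1984PropagatorsII, (2.36) p.229, (2.91)–(2.92) p.239, (2.133)–(2.136) p.247 (mechanism); Balaban1985BackgroundPropagators, p.399 (architecture), Thm 3.1 p.397 (the guard `M ≥ M₁`)] -/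
theorem hasMaj_idef_glued_of_covEntries (htri : Triangle254 g) (hd : ∀ a b : g.Site, 0 ≤ g.dist a b) (hd0 : ∀ y : g.Site, g.dist y y = 0) (hrow : RowSum g σ cr)
    (hσ : 0 ≤ σ) (hcr : 0 ≤ cr) {τ : J → X ≃ X} {τ' : J → X' ≃ X'} {η η' : ℝ} {R : J ⊕ J → X → Matrix ι ι ℝ} {R' : J ⊕ J → X' → Matrix ι ι ℝ}
    {W : (X × ι → ℝ) →ₗ[ℝ] (X × ι → ℝ)} {W' : (X' × ι → ℝ) →ₗ[ℝ] (X' × ι → ℝ)} {h : K → X → ℝ} {h' : K → X' → ℝ} {G : K → (X × ι → ℝ) →ₗ[ℝ] (X × ι → ℝ)}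
    {G' : K → (X' × ι → ℝ) →ₗ[ℝ] (X' × ι → ℝ)} {β β₁ c₁ c₂ θW o o₁ o₂ m₀ m₁ rW δ Nov : ℝ} (hβ : 0 ≤ β) (hβ₁ : 0 ≤ β₁) (hc₁ : 0 ≤ c₁) (hc₂ : 0 ≤ c₂) (hθW : 0 ≤ θW) (ho : 0 ≤ o)
    (ho₁ : 0 ≤ o₁) (ho₂ : 0 ≤ o₂) (hm₀ : 0 ≤ m₀) (hm₁ : 0 ≤ m₁) (hrW : 0 ≤ rW) (hNov : 0 ≤ Nov) (hσδ : 2 * σ ≤ δ)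
    (hh : ∀ i x, |h i x| ≤ 1) (hh' : ∀ i x', |h' i x'| ≤ 1) (hfit : ∀ i (p' : X' × ι), |h' i p'.1 - h i (ϖ p').1| ≤ o) (hN : ∀ a, ∑ i, ind (S i) a ≤ Nov)
    (hh1 : ∀ i μ x, |fgrad η⁻¹ (τ μ) (h i) x| ≤ c₁) (hh1b : ∀ i μ x, |fgradAdj η⁻¹ (τ μ) (h i) x| ≤ c₁) (hh2 : ∀ i μ x, |fgradAdj η⁻¹ (τ μ) (fgrad η⁻¹ (τ μ) (h i)) x| ≤ c₂)
    (hh1' : ∀ i μ x', |fgrad η'⁻¹ (τ' μ) (h' i) x'| ≤ c₁) (hh1b' : ∀ i μ x', |fgradAdj η'⁻¹ (τ' μ) (h' i) x'| ≤ c₁)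
    (hh2' : ∀ i μ x', |fgradAdj η'⁻¹ (τ' μ) (fgrad η'⁻¹ (τ' μ) (h' i)) x'| ≤ c₂)
    (hf1 : ∀ i μ p', |fgrad η'⁻¹ (τ' μ) (h' i) p'.1 - fgrad η⁻¹ (τ μ) (h i) (ϖ p').1| ≤ o₁)
    (hf1b : ∀ i μ p', |fgradAdj η'⁻¹ (τ' μ) (h' i) p'.1 - fgradAdj η⁻¹ (τ μ) (h i) (ϖ p').1| ≤ o₁)
    (hf2 : ∀ i μ p', |fgradAdj η'⁻¹ (τ' μ) (fgrad η'⁻¹ (τ' μ) (h' i)) p'.1 - fgradAdj η⁻¹ (τ μ) (fgrad η⁻¹ (τ μ) (h i)) (ϖ p').1| ≤ o₂)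
    (hG : ∀ i, HasMaj (BlockNorm.ofBlocks g blk) (BlockNorm.ofBlocks g blk) (G i) (fun y y' => ind (S i) y * ind (S i) y' * (β * Real.exp (-(δ * g.dist y y')))))
    (hG' : ∀ i, HasMaj (BlockNorm.ofBlocks g (blk ∘ ϖ)) (BlockNorm.ofBlocks g (blk ∘ ϖ)) (G' i)
      (fun y y' => ind (S i) y * ind (S i) y' * (β * Real.exp (-(δ * g.dist y y')))))
    (hD : ∀ i μ, HasMaj (BlockNorm.ofBlocks g blk) (BlockNorm.ofBlocks g blk) (covD η (R (Sum.inl μ)) (τ μ) ∘ₗ G i)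
      (fun y y' => ind (S i) y * ind (S i) y' * (β₁ * Real.exp (-(δ * g.dist y y')))))
    (hDb : ∀ i μ, HasMaj (BlockNorm.ofBlocks g blk) (BlockNorm.ofBlocks g blk) (covD η (R (Sum.inr μ)) (τ μ).symm ∘ₗ G i)
      (fun y y' => ind (S i) y * ind (S i) y' * (β₁ * Real.exp (-(δ * g.dist y y')))))
    (hD' : ∀ i μ, HasMaj (BlockNorm.ofBlocks g (blk ∘ ϖ)) (BlockNorm.ofBlocks g (blk ∘ ϖ)) (covD η' (R' (Sum.inl μ)) (τ' μ) ∘ₗ G' i)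
      (fun y y' => ind (S i) y * ind (S i) y' * (β₁ * Real.exp (-(δ * g.dist y y')))))
    (hDb' : ∀ i μ, HasMaj (BlockNorm.ofBlocks g (blk ∘ ϖ)) (BlockNorm.ofBlocks g (blk ∘ ϖ)) (covD η' (R' (Sum.inr μ)) (τ' μ).symm ∘ₗ G' i)
      (fun y y' => ind (S i) y * ind (S i) y' * (β₁ * Real.exp (-(δ * g.dist y y')))))
    (hW : ∀ i, HasMaj (BlockNorm.ofBlocks g blk) (BlockNorm.ofBlocks g blk) (commOp W (fun p : X × ι => h i p.1) ∘ₗ G i)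
      (fun y y' => ind (S i) y * ind (S i) y' * (θW * Real.exp (-(δ * g.dist y y')))))
    (hW' : ∀ i, HasMaj (BlockNorm.ofBlocks g (blk ∘ ϖ)) (BlockNorm.ofBlocks g (blk ∘ ϖ)) (commOp W' (fun p' : X' × ι => h' i p'.1) ∘ₗ G' i)
      (fun y y' => ind (S i) y * ind (S i) y' * (θW * Real.exp (-(δ * g.dist y y')))))
    (hDG : ∀ i, HasMaj (BlockNorm.ofBlocks g blk) (BlockNorm.ofBlocks g (blk ∘ ϖ)) (idef (pull ϖ) (pull ϖ) (G' i) (G i))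
      (fun y y' => ind (S i) y * ind (S i) y' * (m₀ * Real.exp (-(δ * g.dist y y')))))
    (hDD : ∀ i μ, HasMaj (BlockNorm.ofBlocks g blk) (BlockNorm.ofBlocks g (blk ∘ ϖ))
      (idef (pull ϖ) (pull ϖ) (covD η' (R' (Sum.inl μ)) (τ' μ) ∘ₗ G' i) (covD η (R (Sum.inl μ)) (τ μ) ∘ₗ G i))
      (fun y y' => ind (S i) y * ind (S i) y' * (m₁ * Real.exp (-(δ * g.dist y y')))))
    (hDDb : ∀ i μ, HasMaj (BlockNorm.ofBlocks g blk) (BlockNorm.ofBlocks g (blk ∘ ϖ))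
      (idef (pull ϖ) (pull ϖ) (covD η' (R' (Sum.inr μ)) (τ' μ).symm ∘ₗ G' i) (covD η (R (Sum.inr μ)) (τ μ).symm ∘ₗ G i))
      (fun y y' => ind (S i) y * ind (S i) y' * (m₁ * Real.exp (-(δ * g.dist y y')))))
    (hDW : ∀ i, HasMaj (BlockNorm.ofBlocks g blk) (BlockNorm.ofBlocks g (blk ∘ ϖ))
      (idef (pull ϖ) (pull ϖ) (commOp W' (fun p' : X' × ι => h' i p'.1) ∘ₗ G' i) (commOp W (fun p : X × ι => h i p.1) ∘ₗ G i))
      (fun y y' => ind (S i) y * ind (S i) y' * (rW * Real.exp (-(δ * g.dist y y')))))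
    (hq : Nov * (Fintype.card J * (c₂ * β + 2 * (c₁ * β₁)) + θW) * cr < 1) :
    HasMaj (BlockNorm.ofBlocks g blk) (BlockNorm.ofBlocks g (blk ∘ ϖ))
      (idef (pull ϖ) (pull ϖ)
        (glueInv (parametrix (fun i (p' : X' × ι) => h' i p'.1) G') (remainder (covLapM τ' η' R' + W') (fun i (p' : X' × ι) => h' i p'.1) G'))
        (glueInv (parametrix (fun i (p : X × ι) => h i p.1) G) (remainder (covLapM τ η R + W) (fun i (p : X × ι) => h i p.1) G)))
      (fun y y' => (Nov * β * ((1 - Nov * (Fintype.card J * (c₂ * β + 2 * (c₁ * β₁)) + θW) * cr)⁻¹ *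
          ((1 - Nov * (Fintype.card J * (c₂ * β + 2 * (c₁ * β₁)) + θW) * cr)⁻¹ *
            (Nov * ((Fintype.card J * (c₂ * β + 2 * (c₁ * β₁)) + θW) * o + (Fintype.card J * (c₂ * m₀ + o₂ * β + 2 * (c₁ * m₁ + o₁ * β₁)) + rW))) * cr) * cr) * cr +
        Nov * (2 * β * o + m₀) * (1 - Nov * (Fintype.card J * (c₂ * β + 2 * (c₁ * β₁)) + θW) * cr)⁻¹ * cr) * Real.exp (-((δ - 2 * σ) * g.dist y y'))) :=
  hasMaj_idef_glued_of_cubes blk ϖ S htri hd hd0 hrow hσ hcr (h := fun i (p : X × ι) => h i p.1) (h' := fun i (p' : X' × ι) => h' i p'.1) hβ (by positivity) hm₀ (by positivity) ho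
    hNov hσδ (fun i p => hh i p.1) (fun i p' => hh' i p'.1) hfit hN hG hG'
    (fun i => hasMaj_commOp_covLapM_comp blk hc₁ hc₂ (hh1 i) (hh1b i) (hh2 i) (hG i) (hD i) (hDb i) (hW i))
    (fun i => hasMaj_commOp_covLapM_comp (blk ∘ ϖ) hc₁ hc₂ (hh1' i) (hh1b' i) (hh2' i) (hG' i) (hD' i) (hDb' i) (hW' i))
    hDG (fun i => hasMaj_idef_commOp_covLapM_comp blk ϖ hc₁ hc₂ ho₁ ho₂ (hh1' i) (hh1b' i) (hh2' i) (hf1 i) (hf1b i) (hf2 i) (hG i) (hD i) (hDb i) (hDG i) (hDD i) (hDDb i) (hDW i))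
    hq

end Glued

end Summit.QuantumFields.YangMills.BalabanUVNodes.N15.Gluing

end
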